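import Summits.Parity.GeneralizedHardyLittlewood.Theorems.LeeYangFibresRelativeDimOneMoebiusSplitStubDefs
import Summits.Parity.GeneralizedHardyLittlewood.Theorems.LeeYangFibresRelativeDimOneMoebiusSplitTermBoundAux1
import Summits.Parity.GeneralizedHardyLittlewood.Theorems.LeeYangFibresRelativeDimOneMoebiusSplitTermBoundAux2
import Summits.Parity.GeneralizedHardyLittlewood.Theorems.LeeYangFibresRelativeDimOneMoebiusSplitMoebiusTermBVAux7
import Literature.NumberTheory.Sieve.LinearEquationsInPrimesDimOne
import Mathlib
import HarnessLib

/-!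
# Route `LeeYangFibres`, crux `RelativeDimOne` (stmt-Parity-14113), line `single-moebius-split`,
# stub `stub_termClassSums` — auxiliary file 1: one class sum along its progression

The single-Möbius class sum `Σ(d, e) = termClassSum Ψ K N R_j j d e` runs over the `n ∈ [-N, N]`
of ONE residue class `n ≡ n₀ (mod M₀)`, `M₀ = lcm_i (q_i / gcd(ψ̇_i, q_i))` with moduli `q_i = d_i`
(`i > j`), `q_j = e`, `q_i = 1` (`i < j`) (`termBound_aux_residue_class`). Writing `n = n₀ + M₀ m`
turns it into a sum over `m ∈ [-Y, Y]`, `Y = ⌊2N/M₀⌋ + 1`, of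
`μ(φ₀(m)) · (∏_{i<j} Λ(φ_{i+1}(m))) · w(m)` cut off by a convex body `K' ⊆ [-Y, Y]`, where
`φ₀(m) = ψ_j(n)/e` (modulus `ψ̇_j M₀ / e`), `φ_{i+1}(m) = ψ_i(n)` (`i < j`, modulus `ψ̇_i M₀`), and the
weight `w(m) = log(φ₀(m)/R_j)` (clipped to `[R_j, 2LN]`, hence monotone and in `[0, log(2LN)]`) —
exactly the input shape of `termBound_aux_abel_atom`. Main statement: `tcs_progression`.
-/

noncomputable section

open scoped BigOperators Classical
open Finset Literature.NumberTheory.Sieve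

namespace Summit.Parity.GeneralizedHardyLittlewood.Cruxes.RelativeDimOne.SingleMoebiusSplit

/-! ### Small helpers -/

/-- Reindexing the forms before `j`: `∏_{i ∈ Iio j} F(i) = ∏_{i : Fin j} F(i)`. -/
theorem tcs_prod_Iio_eq {k : ℕ} (j : Fin (k + 1)) (F : Fin (k + 1) → ℝ) :
    ∏ i ∈ Finset.Iio j, F i = ∏ i : Fin (j : ℕ), F (Fin.castLE j.isLt.le i) := by
  symm
  refine Finset.prod_nbij (fun i => Fin.castLE j.isLt.le i) (fun i _ => ?_) (fun i _ i' _ h => ?_)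
    (fun x hx => ?_) (fun _ _ => rfl)
  · exact Finset.mem_Iio.mpr (Fin.lt_def.mpr (by simp))
  · exact Fin.castLE_injective _ h
  · have hx' : x < j := Finset.mem_Iio.mp (Finset.mem_coe.mp hx)
    exact ⟨⟨x, Fin.lt_def.mp hx'⟩, Finset.mem_coe.mpr (Finset.mem_univ _), Fin.ext rfl⟩

/-- `a / M < ⌊a / M⌋ + 1` for natural numbers, read in `ℝ`. -/
theorem tcs_div_lt_floor_add_one (a M : ℕ) (hM : 1 ≤ M) :
    (a : ℝ) / M < ((a / M + 1 : ℕ) : ℝ) := by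
  have hM0 : (0 : ℝ) < M := by exact_mod_cast hM
  have h := Nat.lt_div_mul_add (a := a) (b := M) hM
  rw [div_lt_iff₀ hM0]
  have h' : (a : ℝ) < ((a / M * M + M : ℕ) : ℝ) := by exact_mod_cast h
  calc (a : ℝ) < ((a / M * M + M : ℕ) : ℝ) := h'
    _ = ((a / M + 1 : ℕ) : ℝ) * M := by push_cast; ring

/-- The pull-back of a convex `K ⊆ ℝ¹` under the affine map `x ↦ (c + M x₀)` is convex. -/
theorem tcs_convex_pullback {K : Set (Fin 1 → ℝ)} (hK : Convex ℝ K) (c M : ℝ) :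
    Convex ℝ {x : Fin 1 → ℝ | (fun _ : Fin 1 => c + M * x 0) ∈ K} := by
  intro x hx y hy a b ha hb hab
  have h := hK hx hy ha hb hab
  have heq : a • (fun _ : Fin 1 => c + M * x 0) + b • (fun _ : Fin 1 => c + M * y 0) =
      fun _ : Fin 1 => c + M * (a • x + b • y) 0 := by
    funext i
    simp only [Pi.add_apply, Pi.smul_apply, smul_eq_mul]
    linear_combination c * hab
  rw [heq] at h
  exact h

/-- The clipped logarithmic weight along an integer progression is monotone or antitone:
`m ↦ log(max(R, min(A m + B, T))/R)` (`R > 0`). -/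
theorem tcs_weight_mono (A B : ℤ) (R T : ℝ) (hR : 0 < R) :
    Monotone (fun m : ℤ => Real.log (max R (min (((A * m + B : ℤ)) : ℝ) T) / R)) ∨
      Antitone (fun m : ℤ => Real.log (max R (min (((A * m + B : ℤ)) : ℝ) T) / R)) := by
  have hg : Monotone (fun x : ℝ => Real.log (max R (min x T) / R)) := by
    intro x y hxy
    have hpos : 0 < max R (min x T) / R := div_pos (lt_of_lt_of_le hR (le_max_left _ _)) hR
    exact Real.log_le_log hpos (div_le_div_of_nonneg_right
      (max_le_max le_rfl (min_le_min hxy le_rfl)) hR.le)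
  rcases le_or_gt 0 A with hA | hA
  · left
    have hh : Monotone (fun m : ℤ => (((A * m + B : ℤ)) : ℝ)) := by
      intro m m' hmm'
      have : A * m + B ≤ A * m' + B := by nlinarith
      dsimp only
      exact_mod_cast this
    exact hg.comp hh
  · right
    have hh : Antitone (fun m : ℤ => (((A * m + B : ℤ)) : ℝ)) := by
      intro m m' hmm'
      have : A * m' + B ≤ A * m + B := by nlinarith
      dsimp only
      exact_mod_cast this
    exact hg.comp_antitone hh

/-! ### One class sum along its progression -/

/-- **One class along its progression.** Let `‖Ψ‖_N ≤ L` (`L, N ≥ 1`), `K ⊆ [-N, N]` convex,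
`R_j ≥ 1`, `e ≥ 1`, `d_i ≥ 1` (`i > j`), moduli `q_i = d_i` (`i > j`), `q_j = e`, `q_i = 1` (`i < j`),
`M₀ = lcm_i (q_i / gcd(ψ̇_i, q_i))`, `Y = ⌊2N/M₀⌋ + 1`, and let `n₀ ∈ [-N, N]` satisfy `d_i ∣ ψ_i(n₀)`
(`i > j`) and `e ∣ ψ_j(n₀)`. Then there are a system `Φ = (φ₀; φ₁, …, φ_j)` with
`e φ₀(m) = ψ_j(n₀ + M₀ m)`, `φ_{i+1}(m) = ψ_i(n₀ + M₀ m)` (`i < j`), a convex `K' ⊆ [-Y, Y]` and a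
monotone (or antitone) weight `0 ≤ w ≤ log(2LN)` such that
`Σ(d, e) = ∑_{m ∈ [-Y, Y]} [(m) ∈ K'] μ(φ₀(m)) (∏_{i<j} Λ(φ_{i+1}(m))) w(m)`. -/
theorem tcs_progression : ∀ (k : ℕ) (j : Fin (k + 1)) (Ψ : Fin (k + 1) → AffLinForm 1)
    (K : Set (Fin 1 → ℝ)) (N L : ℕ) (Rj : ℝ) (d : Fin (k + 1) → ℕ) (e : ℕ) (q : Fin (k + 1) → ℕ)
    (n₀ : ℤ) (M₀ Y : ℕ),
    affLinSize Ψ N ≤ L → 1 ≤ N → 1 ≤ L → Convex ℝ K → K ⊆ realBox 1 N → 1 ≤ Rj → 1 ≤ e →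
    (∀ i ∈ Finset.Ioi j, 1 ≤ d i) →
    (∀ i, q i = if i ∈ Finset.Ioi j then d i else if i = j then e else 1) →
    M₀ = Finset.univ.lcm (fun i => q i / Int.gcd ((Ψ i).coeff 0) (q i)) → Y = 2 * N / M₀ + 1 →
    -(N : ℤ) ≤ n₀ → n₀ ≤ N → (∀ i ∈ Finset.Ioi j, ((d i : ℕ) : ℤ) ∣ (Ψ i).eval (fun _ => n₀)) →
    (e : ℤ) ∣ (Ψ j).eval (fun _ => n₀) →
    ∃ (Φ : Fin ((j : ℕ) + 1) → AffLinForm 1) (K' : Set (Fin 1 → ℝ)) (w : ℤ → ℝ),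
      Convex ℝ K' ∧ K' ⊆ realBox 1 Y ∧ (Monotone w ∨ Antitone w) ∧ (∀ m, 0 ≤ w m) ∧
      (∀ m, w m ≤ Real.log (2 * L * N)) ∧
      ((e : ℤ) * (Φ 0).coeff 0 = (Ψ j).coeff 0 * M₀) ∧
      ((e : ℤ) * (Φ 0).const = (Ψ j).eval (fun _ => n₀)) ∧
      (∀ i : Fin (j : ℕ), (Φ i.succ).coeff 0 = (Ψ (Fin.castLE j.isLt.le i)).coeff 0 * M₀ ∧
        (Φ i.succ).const = (Ψ (Fin.castLE j.isLt.le i)).eval (fun _ => n₀)) ∧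
      (∀ m : ℤ, (e : ℤ) * (Φ 0).eval (fun _ => m) = (Ψ j).eval (fun _ => n₀ + M₀ * m)) ∧
      (∀ (i : Fin (j : ℕ)) (m : ℤ), (Φ i.succ).eval (fun _ => m) =
        (Ψ (Fin.castLE j.isLt.le i)).eval (fun _ => n₀ + M₀ * m)) ∧
      termClassSum Ψ K N Rj j d e =
        ∑ m ∈ Finset.Icc (-(Y : ℤ)) Y, (if (fun _ : Fin 1 => (m : ℝ)) ∈ K' then
          (ArithmeticFunction.moebius ((Φ 0).eval (fun _ => m)).toNat : ℝ) *
            ∏ i : Fin (j : ℕ), intVonMangoldt ((Φ i.succ).eval (fun _ => m)) else 0) * w m := by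
  intro k j Ψ K N L Rj d e q n₀ M₀ Y hsize hN hL hK hKN hRj he hd hq hM₀ hY hn₀l hn₀u hdiv hediv
  -- coefficients
  set a : Fin (k + 1) → ℤ := fun i => (Ψ i).coeff 0 with ha
  set b : Fin (k + 1) → ℤ := fun i => (Ψ i).const with hb
  have heval : ∀ i n, (Ψ i).eval (fun _ => n) = a i * n + b i := fun i n => by
    rw [DimOne.eval_eq]
  have hsz : ∀ i, (a i).natAbs ≤ L ∧ (b i).natAbs ≤ L * N := fun i =>
    natAbs_le_of_affLinSize_le hN hsize i
  have he0 : (e : ℤ) ≠ 0 := by exact_mod_cast (show e ≠ 0 by omega)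
  have he0' : (0 : ℝ) < e := by exact_mod_cast he
  have hRj0 : 0 < Rj := lt_of_lt_of_le one_pos hRj
  -- the moduli
  have hq1 : ∀ i, 1 ≤ q i := by
    intro i
    rw [hq i]
    split_ifs with h1 h2
    exacts [hd i h1, he, le_rfl]
  have hqj : q j = e := by
    rw [hq j, if_neg (fun h => lt_irrefl j (Finset.mem_Ioi.mp h)), if_pos rfl]
  have hM₀1 : 1 ≤ M₀ := hM₀ ▸ one_le_lcm_div_gcd a hq1
  have hM₀0 : (M₀ : ℤ) ≠ 0 := by exact_mod_cast (show M₀ ≠ 0 by omega)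
  have hM₀pos : (0 : ℤ) < M₀ := by exact_mod_cast hM₀1
  have hM₀posR : (0 : ℝ) < M₀ := by exact_mod_cast hM₀1
  -- the divisibility system in terms of `q`
  have hqdiv : ∀ n : ℤ, (∀ i ∈ Finset.Ioi j, ((d i : ℕ) : ℤ) ∣ (Ψ i).eval (fun _ => n)) →
      (e : ℤ) ∣ (Ψ j).eval (fun _ => n) → ∀ i, ((q i : ℕ) : ℤ) ∣ a i * n + b i := by
    intro n h1 h2 i
    rw [← heval, hq i]
    split_ifs with h3 h4
    · exact h1 i h3
    · rw [h4]; exact h2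
    · simp
  have hn₀div : ∀ i, ((q i : ℕ) : ℤ) ∣ a i * n₀ + b i := hqdiv n₀ hdiv hediv
  have hres := termBound_aux_residue_class (k + 1) a b q n₀ hq1 hn₀div
  -- every point of the progression satisfies all the divisibilities
  have hprog : ∀ (m : ℤ) (i), ((q i : ℕ) : ℤ) ∣ a i * (n₀ + M₀ * m) + b i := by
    intro m
    rw [hres, ← hM₀]
    exact ⟨m, by ring⟩
  have hprog_d : ∀ (m : ℤ), ∀ i ∈ Finset.Ioi j,
      ((d i : ℕ) : ℤ) ∣ (Ψ i).eval (fun _ => n₀ + M₀ * m) := by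
    intro m i hi
    have h := hprog m i
    rw [hq i, if_pos hi] at h
    rwa [heval]
  have hprog_e : ∀ m : ℤ, (e : ℤ) ∣ (Ψ j).eval (fun _ => n₀ + M₀ * m) := by
    intro m
    have h := hprog m j
    rw [hqj] at h
    rwa [heval]
  -- conversely, the class is the progression
  have hclass : ∀ n : ℤ, (∀ i ∈ Finset.Ioi j, ((d i : ℕ) : ℤ) ∣ (Ψ i).eval (fun _ => n)) →
      (e : ℤ) ∣ (Ψ j).eval (fun _ => n) → (M₀ : ℤ) ∣ n - n₀ := by
    intro n h1 h2
    have h := (hres n).mp (hqdiv n h1 h2)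
    rwa [← hM₀] at h
  -- `e ∣ ψ̇_j M₀`: write `ψ̇_j M₀ = e A₀`
  have heA : ∃ A₀ : ℤ, (e : ℤ) * A₀ = a j * M₀ := by
    have h1 : q j / Int.gcd (a j) (q j) ∣ M₀ := hM₀ ▸ Finset.dvd_lcm (Finset.mem_univ j)
    rw [hqj] at h1
    obtain ⟨M₁, hM₁⟩ := h1
    obtain ⟨a', ha'⟩ := Int.gcd_dvd_left (a j) e
    have hge : (Int.gcd (a j) e : ℕ) ∣ e := by exact_mod_cast Int.gcd_dvd_right (a j) e
    refine ⟨a' * M₁, ?_⟩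
    calc (e : ℤ) * (a' * M₁) = ((Int.gcd (a j) e * (e / Int.gcd (a j) e) : ℕ) : ℤ) * (a' * M₁) := by
          rw [Nat.mul_div_cancel' hge]
      _ = (Int.gcd (a j) e : ℤ) * a' * (((e / Int.gcd (a j) e) * M₁ : ℕ) : ℤ) := by
          push_cast; ring
      _ = a j * M₀ := by rw [← ha', ← hM₁]
  obtain ⟨A₀, hA₀⟩ := heA
  obtain ⟨B₀, hB₀⟩ := hediv
  -- the dilated system
  set Φ : Fin ((j : ℕ) + 1) → AffLinForm 1 := Fin.cons (⟨fun _ => A₀, B₀⟩ : AffLinForm 1)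
    (fun i : Fin (j : ℕ) => (⟨fun _ => a (Fin.castLE j.isLt.le i) * M₀,
      (Ψ (Fin.castLE j.isLt.le i)).eval (fun _ => n₀)⟩ : AffLinForm 1)) with hΦdef
  have hΦ0 : Φ 0 = ⟨fun _ => A₀, B₀⟩ := by simp only [hΦdef, Fin.cons_zero]
  have hΦs : ∀ i : Fin (j : ℕ), Φ i.succ = ⟨fun _ => a (Fin.castLE j.isLt.le i) * M₀,
      (Ψ (Fin.castLE j.isLt.le i)).eval (fun _ => n₀)⟩ := fun i => by
    simp only [hΦdef, Fin.cons_succ]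
  have hP3 : (e : ℤ) * (Φ 0).coeff 0 = a j * M₀ := by rw [hΦ0]; exact hA₀
  have hP3' : (e : ℤ) * (Φ 0).const = (Ψ j).eval (fun _ => n₀) := by rw [hΦ0, hB₀]
  have hφ₀ : ∀ m : ℤ, (Φ 0).eval (fun _ => m) = A₀ * m + B₀ := fun m => by
    rw [DimOne.eval_eq, hΦ0]
  have hP1 : ∀ m : ℤ, (e : ℤ) * (Φ 0).eval (fun _ => m) = (Ψ j).eval (fun _ => n₀ + M₀ * m) := by
    intro m
    rw [hφ₀, heval]
    have hB₀' : (e : ℤ) * B₀ = a j * n₀ + b j := by rw [← heval, hB₀]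
    linear_combination m * hA₀ + hB₀'
  have hP2 : ∀ (i : Fin (j : ℕ)) (m : ℤ), (Φ i.succ).eval (fun _ => m) =
      (Ψ (Fin.castLE j.isLt.le i)).eval (fun _ => n₀ + M₀ * m) := by
    intro i m
    rw [DimOne.eval_eq, hΦs, heval, heval]
    ring
  -- the dilated forms (all indices) and the body
  set χ : Fin (k + 1) → AffLinForm 1 := fun i => ⟨fun _ => a i * M₀, a i * n₀ + b i⟩ with hχdef
  have hχ : ∀ (i) (m : ℤ), (χ i).realEval (fun _ => (m : ℝ)) =
      (((Ψ i).eval (fun _ => n₀ + M₀ * m) : ℤ) : ℝ) := by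
    intro i m
    rw [DimOne.realEval_eq, heval]
    simp only [hχdef]
    push_cast
    ring
  have hpt : ∀ m : ℤ, (fun _ : Fin 1 => (n₀ : ℝ) + (M₀ : ℝ) * (m : ℝ)) =
      fun _ : Fin 1 => (((n₀ + M₀ * m : ℤ)) : ℝ) := by
    intro m; funext i; push_cast; ring
  set K' : Set (Fin 1 → ℝ) := {x | (fun _ : Fin 1 => (n₀ : ℝ) + (M₀ : ℝ) * x 0) ∈ K} ∩
    ((⋂ i, {x | (0 : ℝ) < (χ i).realEval x}) ∩ {x | Rj * e < (χ j).realEval x}) with hK'def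
  have hmemK' : ∀ m : ℤ, (fun _ : Fin 1 => (m : ℝ)) ∈ K' ↔
      ((fun _ : Fin 1 => (((n₀ + M₀ * m : ℤ)) : ℝ)) ∈ K ∧
        (∀ i, 0 < (Ψ i).eval (fun _ => n₀ + M₀ * m)) ∧
        Rj * e < (((Ψ j).eval (fun _ => n₀ + M₀ * m) : ℤ) : ℝ)) := by
    intro m
    simp only [hK'def, Set.mem_inter_iff, Set.mem_setOf_eq, Set.mem_iInter, hχ, hpt, Int.cast_pos]
  -- the weight
  set w : ℤ → ℝ := fun m => Real.log (max Rj (min ((((Φ 0).eval (fun _ => m)) : ℤ) : ℝ)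
    (2 * L * N)) / Rj) with hwdef
  have hT1 : (1 : ℝ) ≤ 2 * L * N := by
    have h1 : (1 : ℝ) ≤ L := by exact_mod_cast hL
    have h2 : (1 : ℝ) ≤ N := by exact_mod_cast hN
    nlinarith
  have hw0 : ∀ m, 0 ≤ w m := by
    intro m
    simp only [hwdef]
    refine Real.log_nonneg ?_
    rw [le_div_iff₀ hRj0, one_mul]
    exact le_max_left _ _
  have hwG : ∀ m, w m ≤ Real.log (2 * L * N) := by
    intro m
    simp only [hwdef]
    have hpos : 0 < max Rj (min ((((Φ 0).eval (fun _ => m)) : ℤ) : ℝ) (2 * L * N)) / Rj :=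
      div_pos (lt_of_lt_of_le hRj0 (le_max_left _ _)) hRj0
    refine Real.log_le_log hpos ?_
    rw [div_le_iff₀ hRj0]
    refine max_le ?_ ((min_le_right _ _).trans ?_)
    · nlinarith
    · nlinarith
  have hwmono : Monotone w ∨ Antitone w := by
    have hfun : w = fun m : ℤ => Real.log (max Rj (min (((A₀ * m + B₀ : ℤ)) : ℝ) (2 * L * N)) / Rj) := by
      funext m; simp only [hwdef, hφ₀]
    rw [hfun]
    exact tcs_weight_mono A₀ B₀ Rj (2 * L * N) hRj0
  -- bounds on `|n - n₀|` for `n, n₀ ∈ [-N, N]` read through `Y`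
  have hYdef' : ((Y : ℕ) : ℤ) = 2 * N / M₀ + 1 := by rw [hY]; push_cast; rfl
  have hYR : (2 * N : ℝ) / M₀ < (Y : ℝ) := by
    have h := tcs_div_lt_floor_add_one (2 * N) M₀ hM₀1
    rw [hY]; push_cast at h ⊢; exact h
  refine ⟨Φ, K', w, ?_, ?_, hwmono, hw0, hwG, hP3, hP3', fun i => ⟨by rw [hΦs], by rw [hΦs]⟩,
    hP1, hP2, ?_⟩
  · -- convexity of `K'`
    rw [hK'def]
    exact (tcs_convex_pullback hK _ _).inter
      ((convex_iInter fun i => (χ i).convex_realEval_gt 0).inter ((χ j).convex_realEval_gt _))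
  · -- `K' ⊆ [-Y, Y]`
    intro x hx
    rw [hK'def] at hx
    have hx1 : (fun _ : Fin 1 => (n₀ : ℝ) + (M₀ : ℝ) * x 0) ∈ K := hx.1
    have h1 := hKN hx1
    have hl : -(N : ℝ) ≤ (n₀ : ℝ) + (M₀ : ℝ) * x 0 := h1.1 0
    have hu : (n₀ : ℝ) + (M₀ : ℝ) * x 0 ≤ N := h1.2 0
    have hn₀l' : -(N : ℝ) ≤ n₀ := by exact_mod_cast hn₀l
    have hn₀u' : (n₀ : ℝ) ≤ N := by exact_mod_cast hn₀u
    have hxu : x 0 ≤ (2 * N : ℝ) / M₀ := by rw [le_div_iff₀ hM₀posR]; linarith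
    have hxl : -((2 * N : ℝ) / M₀) ≤ x 0 := by rw [neg_le, le_div_iff₀ hM₀posR]; linarith
    constructor
    · intro i
      rw [Subsingleton.elim i 0]
      linarith
    · intro i
      rw [Subsingleton.elim i 0]
      linarith
  · -- the reindexed sum
    simp_rw [ite_mul, zero_mul]
    rw [← Finset.sum_filter]
    unfold termClassSum
    symm
    refine Finset.sum_nbij' (fun m => n₀ + M₀ * m) (fun n => (n - n₀) / M₀) ?_ ?_ ?_ ?_ ?_
    · -- progression points of `K'` lie in the class
      intro m hm
      rw [Finset.mem_filter] at hm
      obtain ⟨-, hm⟩ := hm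
      rw [hmemK'] at hm
      obtain ⟨h1, h2, h3⟩ := hm
      have hbox := hKN h1
      have hl : -(N : ℝ) ≤ (((n₀ + M₀ * m : ℤ)) : ℝ) := hbox.1 0
      have hu : (((n₀ + M₀ * m : ℤ)) : ℝ) ≤ N := hbox.2 0
      refine Finset.mem_filter.mpr ⟨Finset.mem_Icc.mpr ⟨?_, ?_⟩, h1, h2, hprog_d m, hprog_e m, h3⟩
      · exact_mod_cast hl
      · exact_mod_cast hu
    · -- class points come from `[-Y, Y]`
      intro n hn
      rw [Finset.mem_filter] at hn
      obtain ⟨hnI, h1, h2, h3, h4, h5⟩ := hn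
      obtain ⟨m, hm⟩ := hclass n h3 h4
      have hn' : n = n₀ + M₀ * m := by linarith
      have hdiv' : (n - n₀) / (M₀ : ℤ) = m := by rw [hm, Int.mul_ediv_cancel_left _ hM₀0]
      rw [hdiv']
      subst hn'
      obtain ⟨hnl, hnu⟩ := Finset.mem_Icc.mp hnI
      refine Finset.mem_filter.mpr ⟨Finset.mem_Icc.mpr ⟨?_, ?_⟩, (hmemK' m).mpr ⟨h1, h2, h5⟩⟩
      · have h6 : -m ≤ 2 * (N : ℤ) / M₀ :=
          Int.le_ediv_of_mul_le hM₀pos (by linarith)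
        rw [hYdef']
        linarith
      · have h6 : m ≤ 2 * (N : ℤ) / M₀ :=
          Int.le_ediv_of_mul_le hM₀pos (by linarith)
        rw [hYdef']
        linarith
    · intro m _
      simp only [add_sub_cancel_left, Int.mul_ediv_cancel_left _ hM₀0]
    · intro n hn
      rw [Finset.mem_filter] at hn
      obtain ⟨-, -, -, h3, h4, -⟩ := hn
      rw [Int.mul_ediv_cancel' (hclass n h3 h4)]
      ring
    · -- the summands agree
      intro m hm
      rw [Finset.mem_filter] at hm
      obtain ⟨-, hm⟩ := hm
      have hm' := (hmemK' m).mp hm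
      obtain ⟨h1, h2, h3⟩ := hm'
      -- `ψ_j(n) = e φ₀(m)`
      have hEq := hP1 m
      have hdivE : (Ψ j).eval (fun _ => n₀ + M₀ * m) / (e : ℤ) = (Φ 0).eval (fun _ => m) := by
        rw [← hEq, Int.mul_ediv_cancel_left _ he0]
      have hcastE : (((Ψ j).eval (fun _ => n₀ + M₀ * m) : ℤ) : ℝ) =
          (e : ℝ) * ((((Φ 0).eval (fun _ => m)) : ℤ) : ℝ) := by
        rw [← hEq]; push_cast; ring
      -- the range of `φ₀(m)` on the class: `R_j < φ₀(m) ≤ 2LN`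
      have hlow : Rj < ((((Φ 0).eval (fun _ => m)) : ℤ) : ℝ) := by
        rw [hcastE, mul_comm] at h3
        exact lt_of_mul_lt_mul_left h3 he0'.le
      have hbox := hKN h1
      have hl : -(N : ℝ) ≤ (((n₀ + M₀ * m : ℤ)) : ℝ) := hbox.1 0
      have hu : (((n₀ + M₀ * m : ℤ)) : ℝ) ≤ N := hbox.2 0
      have hup : ((((Φ 0).eval (fun _ => m)) : ℤ) : ℝ) ≤ 2 * L * N := by
        have hψ : (((Ψ j).eval (fun _ => n₀ + M₀ * m) : ℤ) : ℝ) ≤ 2 * L * N := by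
          have hl' : -(N : ℤ) ≤ n₀ + M₀ * m := by exact_mod_cast hl
          have hu' : n₀ + M₀ * m ≤ N := by exact_mod_cast hu
          have hab : |a j| ≤ L := by
            rw [← Int.natCast_natAbs]; exact_mod_cast (hsz j).1
          have hbb : |b j| ≤ L * N := by
            rw [← Int.natCast_natAbs]; exact_mod_cast (hsz j).2
          have hnn : |n₀ + M₀ * m| ≤ N := abs_le.mpr ⟨hl', hu'⟩
          have hZ : (Ψ j).eval (fun _ => n₀ + M₀ * m) ≤ 2 * L * N := by
            rw [heval]
            calc a j * (n₀ + M₀ * m) + b j ≤ |a j * (n₀ + M₀ * m) + b j| := le_abs_self _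
              _ ≤ |a j| * |n₀ + M₀ * m| + |b j| := by
                  rw [← abs_mul]; exact abs_add_le _ _
              _ ≤ L * N + L * N := by
                  refine add_le_add (mul_le_mul hab hnn (abs_nonneg _) (by positivity)) hbb
              _ = 2 * L * N := by ring
          exact_mod_cast hZ
        have hφpos : 0 ≤ ((((Φ 0).eval (fun _ => m)) : ℤ) : ℝ) := by linarith
        have h1e : (1 : ℝ) ≤ e := by exact_mod_cast he
        rw [hcastE] at hψ
        nlinarith
      have hwm : w m = Real.log (((((Φ 0).eval (fun _ => m)) : ℤ) : ℝ) / Rj) := by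
        simp only [hwdef]
        rw [min_eq_left hup, max_eq_right hlow.le]
      -- assemble
      rw [hdivE, hcastE, mul_div_mul_left _ _ he0'.ne', hwm,
        tcs_prod_Iio_eq j (fun i => intVonMangoldt ((Ψ i).eval (fun _ => n₀ + M₀ * m)))]
      simp only [← hP2]
      ring

end Summit.Parity.GeneralizedHardyLittlewood.Cruxes.RelativeDimOne.SingleMoebiusSplit
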